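import Summits.CriticalPhenomena.SAWScalingLimit.Theorems.SAWLeftRightFKGLeftRightFKGDefs
import HarnessLib

/-!
# Crux `LeftRightFKG` (stmt-CriticalPhenomena-11232), line `corner-localisation` (v9):
FKG transfer along a bijection onto a finite distributive lattice (`stub_fkgTransfer`, tool T3)

The classical FKG mechanism made available for families of crux instances whose chord poset is a
distributive lattice. If the (finitely many) SAW chords of `(Ω, δ, a, b)` map BIJECTIVELY (`f`) onto a
finite distributive lattice `α` so that `f γ₁ ≤ f γ₂` implies the left–right order `γ₁ ≼ γ₂` (`lr`) and
chord length is SUBMODULAR along `f` (`|f⁻¹(p ⊓ q)| + |f⁻¹(p ⊔ q)| ≤ |f⁻¹ p| + |f⁻¹ q|`), then for every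
fugacity `0 ≤ x ≤ 1` the chord measure `μx x` (`γ ↦ x^{|γ|}`) is positively associated in the crux's
event form `μ(A) μ(B) ≤ μ(univ) μ(A ∩ B)` for `≼`-up-closed `A`, `B`.

Proof. Transport to `α` along `e = Equiv.ofBijective f`: the weight `p ↦ x^{|e⁻¹ p|}` is
log-supermodular (`x^{|e⁻¹p|} x^{|e⁻¹q|} = x^{a+b} ≤ x^{c+d}` because `c + d ≤ a + b` and `x ≤ 1`,
`pow_le_pow_of_le_one`), the indicators of the up-sets `A`, `B` pull back to monotone `{0,1}`-valued
functions on `α`, and Mathlib's Fortuin–Kasteleyn–Ginibre inequality `fkg`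
(`Mathlib/Combinatorics/SetFamily/FourFunctions.lean`, a corollary of the four functions theorem) gives
the real inequality between the four partition functions; the sums are carried back to chords with
`Fintype.sum_equiv`, and `CornerLoc.μx_apply_eq_ofReal` (`0 ≤ x`) converts the measures of sets of
chords to `ENNReal.ofReal` of these partition functions. No named unproved facts are used.
-/

open Literature.Probability.LatticeModels Literature.Probability.RandomPlanarGeometry
open Summit.CriticalPhenomena.SAWScalingLimit.Theorems.LeftRightFKG.CornerLoc (lr IsUp μx dom IsInst)
open scoped Classical ENNReal

namespace Summit.CriticalPhenomena.SAWScalingLimit.Theorems.LeftRightFKG.Families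

/-- STUB T3 `stub_fkgTransfer`: FKG TRANSFER. If the chords of `(Ω, δ, a, b)` (a finite type) map
BIJECTIVELY to a finite distributive lattice `α` so that `f γ₁ ≤ f γ₂` implies `γ₁ ≼ γ₂` and chord
length is submodular along `f` (`|f⁻¹(p ⊓ q)| + |f⁻¹(p ⊔ q)| ≤ |f⁻¹ p| + |f⁻¹ q|`), then for every
fugacity `0 ≤ x ≤ 1` the measure `μx x` is positively associated in the crux's event form:
`μ(A) μ(B) ≤ μ(univ) μ(A ∩ B)` for `≼`-up-closed `A, B`. Proof: transport to `α`; `x^{|·|}` is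
log-supermodular (`x ≤ 1`, submodularity, `pow_le_pow_of_le_one`); indicators of up-sets are
monotone; Mathlib's `fkg` (four functions theorem); `CornerLoc.μx_apply_eq_ofReal`.
[cite: FortuinKasteleynGinibre1971, Thm 1] -/
theorem stub_fkgTransfer : ∀ (Ω : Set ℂ) (δ : ℝ) (a b : Site 2) [Fintype (SAW.DomainSAW Ω δ a b)]
    (α : Type) [DistribLattice α] [Fintype α] (f : SAW.DomainSAW Ω δ a b → α), Function.Bijective f →
    (∀ γ₁ γ₂, f γ₁ ≤ f γ₂ → lr γ₁ γ₂) →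
    (∀ γ₁ γ₂ γ₃ γ₄, f γ₃ = f γ₁ ⊓ f γ₂ → f γ₄ = f γ₁ ⊔ f γ₂ → γ₃.length + γ₄.length ≤ γ₁.length + γ₂.length) →
    ∀ x : ℝ, 0 ≤ x → x ≤ 1 → ∀ A B : Set (SAW.DomainSAW Ω δ a b), IsUp A → IsUp B →
      μx x Ω δ a b A * μx x Ω δ a b B ≤ μx x Ω δ a b Set.univ * μx x Ω δ a b (A ∩ B) := by
  intro Ω δ a b _ α _ _ f hf hlr hsub x hx hx1 A B hA hB
  -- replace the bijection `f` by the equivalence `e` it defines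
  obtain ⟨e, rfl⟩ : ∃ e : SAW.DomainSAW Ω δ a b ≃ α, ⇑e = f := ⟨Equiv.ofBijective f hf, rfl⟩
  have hfe : ∀ p, e (e.symm p) = p := e.apply_symm_apply
  -- the indicators of the up-sets, pulled back to `α`, are nonnegative and monotone
  have hnn : ∀ S : Set (SAW.DomainSAW Ω δ a b),
      (0 : α → ℝ) ≤ fun p => if e.symm p ∈ S then (1 : ℝ) else 0 := fun S p => by
    show (0 : ℝ) ≤ if e.symm p ∈ S then (1 : ℝ) else 0
    split_ifs <;> norm_num
  have hmono : ∀ S : Set (SAW.DomainSAW Ω δ a b), IsUp S →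
      Monotone fun p => if e.symm p ∈ S then (1 : ℝ) else 0 := by
    intro S hS p q hpq
    have hl : lr (e.symm p) (e.symm q) := hlr _ _ (by rwa [hfe, hfe])
    show (if e.symm p ∈ S then (1 : ℝ) else 0) ≤ if e.symm q ∈ S then (1 : ℝ) else 0
    by_cases hp : e.symm p ∈ S
    · rw [if_pos hp, if_pos (hS _ _ hl hp)]
    · rw [if_neg hp]
      split_ifs <;> norm_num
  -- the transported weight `p ↦ x^{|e⁻¹ p|}` satisfies the FKG lattice condition (`x ≤ 1`)
  have hwl : ∀ p q : α, x ^ (e.symm p).length * x ^ (e.symm q).length ≤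
      x ^ (e.symm (p ⊓ q)).length * x ^ (e.symm (p ⊔ q)).length := by
    intro p q
    rw [← pow_add, ← pow_add]
    exact pow_le_pow_of_le_one hx hx1
      (hsub _ _ _ _ (by rw [hfe, hfe, hfe]) (by rw [hfe, hfe, hfe]))
  -- Mathlib's FKG inequality on `α`
  have key := fkg (fun p => if e.symm p ∈ A then (1 : ℝ) else 0)
    (fun p => if e.symm p ∈ B then (1 : ℝ) else 0) (fun p => x ^ (e.symm p).length)
    (fun p => pow_nonneg hx _) (hnn A) (hnn B) (hmono A hA) (hmono B hB) hwl
  -- restricted partition functions, transported to `α`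
  have hS : ∀ S : Set (SAW.DomainSAW Ω δ a b), ∑ γ ∈ Finset.univ.filter (· ∈ S), x ^ γ.length =
      ∑ p, x ^ (e.symm p).length * (if e.symm p ∈ S then (1 : ℝ) else 0) := by
    intro S
    rw [Finset.sum_filter]
    refine (Fintype.sum_equiv e.symm _ _ fun p => ?_).symm
    simp only [mul_ite, mul_one, mul_zero]
  have h0 : ∀ S : Set (SAW.DomainSAW Ω δ a b),
      0 ≤ ∑ γ ∈ Finset.univ.filter (· ∈ S), x ^ γ.length :=
    fun S => Finset.sum_nonneg fun γ _ => pow_nonneg hx _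
  -- the measures are `ofReal` of the partition functions
  rw [CornerLoc.μx_apply_eq_ofReal hx A, CornerLoc.μx_apply_eq_ofReal hx B,
    CornerLoc.μx_apply_eq_ofReal hx Set.univ, CornerLoc.μx_apply_eq_ofReal hx (A ∩ B),
    ← ENNReal.ofReal_mul (h0 A), ← ENNReal.ofReal_mul (h0 Set.univ)]
  refine ENNReal.ofReal_le_ofReal ?_
  rw [hS A, hS B, hS Set.univ, hS (A ∩ B)]
  refine key.trans_eq ?_
  congr 1
  · simp
  · refine Finset.sum_congr rfl fun p _ => ?_
    by_cases hpA : e.symm p ∈ A <;> by_cases hpB : e.symm p ∈ B <;> simp [hpA, hpB]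

end Summit.CriticalPhenomena.SAWScalingLimit.Theorems.LeftRightFKG.Families
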